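import Summits.CriticalPhenomena.PercolationContinuityZ3.Theorems.PercNearOneGluingNoHeavyLowerTailQ44bGluingAB
import Summits.CriticalPhenomena.PercolationContinuityZ3.Theorems.PercNearOneGluingNoHeavyLowerTailQ44bPencilAtC
import HarnessLib

/-!
# Gluing a pair between the clusters of `a` and `c`: the cells of `Q44b` after `ω ↦ ω ∪ {s(x,z)}` (tools)

Support file for crux `stmt-CriticalPhenomena-4575` (master-family programme, quadratic four-point row `Q44b` of
`prim-bnk-1` gen 13, OPEN for all `n`), seat `prim-l12-p6` gen 12; memo
`run/shared/lean/prim/prim-l12/FROM-prim-l12-p6-g12-K8-CENSUS.md` §7.  Companion of `…Q44bGluingAB.lean` for the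
pencil of a pair `s(x,z)` with `x` surely joined to `a` and `z` surely joined to the terminal `c`: on `{a~x} ∩ {c~z}`
the events `AC`, `X`, `C¬A`, `X′` of `ω ∪ {s(x,z)}` are described (`Q44b.insert_mem_evAC_iff_c`, `…evX_iff_c`,
`…evCnA_iff_c`, `…evXp_iff_c`), and the resulting events are cut into the cells that occur in the four-point
inequality `Q44bExchange.pencilAtC` (set identities and disjointness).  Used by `…Q44bPencilIntoC.lean`.
Theorems only; no named facts, no sorries, standard axioms.
-/

noncomputable section

namespace Summit.CriticalPhenomena.PercolationContinuityZ3.Theorems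

namespace Q44b

open MeasureTheory Set Literature.Probability.LatticeModels Literature.Probability.Percolation
open scoped Classical

variable {n : ℕ}

/-- Membership in `{u ↔ v}` (by `Iff.rfl`; local copy, cf. `knThm2_mem_openConn`). [folklore] -/
private theorem mem_oc (ω : BondConfig (Fin n)) (u v : Fin n) :
    ω ∈ (openConn u v : Set (BondConfig (Fin n))) ↔ (openGraph ω).Reachable u v := Iff.rfl

/-! ### The events after gluing `a` to `c` (pointwise, on `{a ~ x} ∩ {c ~ z}`) -/

section pointwise

variable (ω : BondConfig (Fin n)) {a b c y x z : Fin n}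

/-- After adding `s(x,z)` (`x ∈ C(a)`, `z ∈ C(c)`): `AC` becomes `{b ~ a or c} ∩ {y ~ c or a}`. [this work] -/
theorem insert_mem_evAC_iff_c (hax : (openGraph ω).Reachable a x) (hcz : (openGraph ω).Reachable c z) :
    insert s(x, z) ω ∈ evAC a b c y ↔
      ω ∈ ((openConn a b ∪ openConn c b) ∩ (openConn c y ∪ openConn a y) : Set (BondConfig (Fin n))) := by
  simp only [evAC, mem_inter_iff, mem_union, mem_oc, reachable_insert_iff_ab ω hax hcz]
  constructor
  · rintro ⟨h1, h2⟩
    refine ⟨?_, ?_⟩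
    · rcases h1 with h | ⟨-, h⟩ | ⟨-, h⟩
      · exact Or.inl h
      · exact Or.inr h
      · exact Or.inl h
    · rcases h2 with h | ⟨-, h⟩ | ⟨-, h⟩
      · exact Or.inl h
      · exact Or.inl h
      · exact Or.inr h
  · rintro ⟨h1, h2⟩
    refine ⟨?_, ?_⟩
    · rcases h1 with h | h
      · exact Or.inl h
      · exact Or.inr (Or.inl ⟨SimpleGraph.Reachable.refl _, h⟩)
    · rcases h2 with h | h
      · exact Or.inl h
      · exact Or.inr (Or.inr ⟨SimpleGraph.Reachable.refl _, h⟩)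

/-- After adding `s(x,z)`: `X` becomes `{b ≁ a, b ≁ c, b ~ y}`. [this work] -/
theorem insert_mem_evX_iff_c (hax : (openGraph ω).Reachable a x) (hcz : (openGraph ω).Reachable c z) :
    insert s(x, z) ω ∈ evX a b c y ↔
      ω ∈ ((openConn a b)ᶜ ∩ (openConn c b)ᶜ ∩ openConn b y : Set (BondConfig (Fin n))) := by
  simp only [evX, mem_inter_iff, mem_union, mem_compl_iff, mem_oc, reachable_insert_iff_ab ω hax hcz]
  constructor
  · rintro ⟨hab, h⟩
    have nab : ¬ (openGraph ω).Reachable a b := fun h' => hab (Or.inl h')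
    have ncb : ¬ (openGraph ω).Reachable c b := fun h' => hab (Or.inr (Or.inl ⟨SimpleGraph.Reachable.refl _, h'⟩))
    refine ⟨⟨nab, ncb⟩, ?_⟩
    rcases h with ⟨-, hby⟩ | ⟨-, hbc⟩
    · rcases hby with h' | ⟨h', -⟩ | ⟨h', -⟩
      · exact h'
      · exact absurd h'.symm nab
      · exact absurd h'.symm ncb
    · rcases hbc with h' | ⟨h', -⟩ | ⟨h', -⟩
      · exact absurd h'.symm ncb
      · exact absurd h'.symm nab
      · exact absurd h'.symm ncb
  · rintro ⟨⟨nab, ncb⟩, hby⟩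
    refine ⟨?_, Or.inl ⟨Or.inr (Or.inl ⟨SimpleGraph.Reachable.refl _, SimpleGraph.Reachable.refl _⟩), Or.inl hby⟩⟩
    rintro (h | ⟨-, h⟩ | ⟨-, h⟩)
    · exact nab h
    · exact ncb h
    · exact nab h

/-- After adding `s(x,z)`: `C¬A` becomes `{y ~ c or a} ∩ {b ≁ a, b ≁ c}`. [this work] -/
theorem insert_mem_evCnA_iff_c (hax : (openGraph ω).Reachable a x) (hcz : (openGraph ω).Reachable c z) :
    insert s(x, z) ω ∈ evCnA a b c y ↔
      ω ∈ ((openConn c y ∪ openConn a y) ∩ (openConn a b)ᶜ ∩ (openConn c b)ᶜ : Set (BondConfig (Fin n))) := by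
  simp only [evCnA, mem_inter_iff, mem_union, mem_compl_iff, mem_oc, reachable_insert_iff_ab ω hax hcz]
  constructor
  · rintro ⟨h2, hab⟩
    have nab : ¬ (openGraph ω).Reachable a b := fun h' => hab (Or.inl h')
    have ncb : ¬ (openGraph ω).Reachable c b := fun h' => hab (Or.inr (Or.inl ⟨SimpleGraph.Reachable.refl _, h'⟩))
    refine ⟨⟨?_, nab⟩, ncb⟩
    rcases h2 with h | ⟨-, h⟩ | ⟨-, h⟩
    · exact Or.inl h
    · exact Or.inl h
    · exact Or.inr h
  · rintro ⟨⟨h2, nab⟩, ncb⟩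
    refine ⟨?_, ?_⟩
    · rcases h2 with h | h
      · exact Or.inl h
      · exact Or.inr (Or.inr ⟨SimpleGraph.Reachable.refl _, h⟩)
    · rintro (h | ⟨-, h⟩ | ⟨-, h⟩)
      · exact nab h
      · exact ncb h
      · exact nab h

/-- After adding `s(x,z)`: `X′` becomes `{b ≁ a, b ≁ c, y ≁ a, y ≁ c, b ≁ y}`. [this work] -/
theorem insert_mem_evXp_iff_c (hax : (openGraph ω).Reachable a x) (hcz : (openGraph ω).Reachable c z) :
    insert s(x, z) ω ∈ evXp a b c y ↔
      ω ∈ ((openConn a b)ᶜ ∩ (openConn c b)ᶜ ∩ (openConn a y)ᶜ ∩ (openConn c y)ᶜ ∩ (openConn b y)ᶜ :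
        Set (BondConfig (Fin n))) := by
  simp only [evXp, mem_inter_iff, mem_union, mem_compl_iff, mem_oc, reachable_insert_iff_ab ω hax hcz]
  constructor
  · rintro ⟨hab, h⟩
    have nab : ¬ (openGraph ω).Reachable a b := fun h' => hab (Or.inl h')
    have ncb : ¬ (openGraph ω).Reachable c b := fun h' => hab (Or.inr (Or.inl ⟨SimpleGraph.Reachable.refl _, h'⟩))
    rcases h with ⟨⟨-, hay⟩, hby⟩ | ⟨⟨-, hac⟩, -⟩
    · have nay : ¬ (openGraph ω).Reachable a y := fun h' => hay (Or.inl h')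
      have ncy : ¬ (openGraph ω).Reachable c y :=
        fun h' => hay (Or.inr (Or.inl ⟨SimpleGraph.Reachable.refl _, h'⟩))
      exact ⟨⟨⟨⟨nab, ncb⟩, nay⟩, ncy⟩, fun h' => hby (Or.inl h')⟩
    · exact absurd (Or.inr (Or.inl ⟨SimpleGraph.Reachable.refl _, SimpleGraph.Reachable.refl _⟩)) hac
  · rintro ⟨⟨⟨⟨nab, ncb⟩, nay⟩, ncy⟩, nby⟩
    refine ⟨?_, Or.inl ⟨⟨Or.inr (Or.inl ⟨SimpleGraph.Reachable.refl _, SimpleGraph.Reachable.refl _⟩), ?_⟩, ?_⟩⟩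
    · rintro (h | ⟨-, h⟩ | ⟨-, h⟩)
      · exact nab h
      · exact ncb h
      · exact nab h
    · rintro (h | ⟨-, h⟩ | ⟨-, h⟩)
      · exact nay h
      · exact ncy h
      · exact nay h
    · rintro (h | ⟨h, -⟩ | ⟨h, -⟩)
      · exact nby h
      · exact nab h.symm
      · exact ncb h.symm

end pointwise

/-! ### Set identities among the cells (forms of `Q44bExchange.pencilAtC`) -/

section cells

variable (a b c y : Fin n)

/-- `{b ~ a or c} ∩ {y ~ c or a} = AC ⊔ aby|c ⊔ ay|bc ⊔ a|bcy`. [this work] -/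
theorem glueAC_union_eq :
    ((openConn a b ∪ openConn c b) ∩ (openConn c y ∪ openConn a y) : Set (BondConfig (Fin n))) =
      ((evAC a b c y ∪
          ((openConn a c)ᶜ ∩ (openConn b c)ᶜ ∩ (openConn y c)ᶜ ∩ (openConn a b ∩ openConn a y))) ∪
        ((openConn a b)ᶜ ∩ (openConn a c)ᶜ ∩ openConn a y ∩ openConn b c)) ∪
      evPend a b c y := by
  ext ω
  simp only [evAC, evPend, mem_union, mem_inter_iff, mem_compl_iff, mem_oc]
  constructor
  · rintro ⟨h1, h2⟩
    by_cases hab : (openGraph ω).Reachable a b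
    · by_cases hcy : (openGraph ω).Reachable c y
      · exact Or.inl (Or.inl (Or.inl ⟨hab, hcy⟩))
      · have hay : (openGraph ω).Reachable a y := h2.resolve_left hcy
        refine Or.inl (Or.inl (Or.inr ⟨⟨⟨fun h => hcy (h.symm.trans hay), fun h => hcy ((h.symm.trans hab.symm).trans hay)⟩,
          fun h => hcy h.symm⟩, hab, hay⟩))
    · have hcb : (openGraph ω).Reachable c b := h1.resolve_left hab
      have nac : ¬ (openGraph ω).Reachable a c := fun h => hab (h.trans hcb)
      by_cases hcy : (openGraph ω).Reachable c y
      · exact Or.inr ⟨⟨⟨⟨hab, nac⟩, fun h => hab ((h.trans hcy.symm).trans hcb)⟩, hcb.symm⟩, hcb.symm.trans hcy⟩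
      · have hay : (openGraph ω).Reachable a y := h2.resolve_left hcy
        exact Or.inl (Or.inr ⟨⟨⟨hab, nac⟩, hay⟩, hcb.symm⟩)
  · rintro (((⟨hab, hcy⟩ | ⟨-, hab, hay⟩) | ⟨⟨-, hay⟩, hbc⟩) | ⟨⟨-, hbc⟩, hby⟩)
    · exact ⟨Or.inl hab, Or.inl hcy⟩
    · exact ⟨Or.inl hab, Or.inr hay⟩
    · exact ⟨Or.inr hbc.symm, Or.inr hay⟩
    · exact ⟨Or.inr hbc.symm, Or.inl (hbc.symm.trans hby)⟩

/-- `AC` and `aby|c` are disjoint. [this work] -/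
theorem disjoint_AC_abyc :
    Disjoint (evAC a b c y)
      ((openConn a c)ᶜ ∩ (openConn b c)ᶜ ∩ (openConn y c)ᶜ ∩ (openConn a b ∩ openConn a y) :
        Set (BondConfig (Fin n))) := by
  rw [Set.disjoint_left]
  intro ω h1 h2
  have hcy : (openGraph ω).Reachable c y := h1.2
  exact absurd hcy.symm h2.1.2

/-- `AC ⊔ aby|c` and `ay|bc` are disjoint. [this work] -/
theorem disjoint_ACabyc_aybc :
    Disjoint (evAC a b c y ∪
        ((openConn a c)ᶜ ∩ (openConn b c)ᶜ ∩ (openConn y c)ᶜ ∩ (openConn a b ∩ openConn a y)))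
      ((openConn a b)ᶜ ∩ (openConn a c)ᶜ ∩ openConn a y ∩ openConn b c : Set (BondConfig (Fin n))) := by
  rw [Set.disjoint_left]
  rintro ω (h1 | h1) h2
  · exact absurd h1.1 h2.1.1.1
  · exact absurd h1.2.1 h2.1.1.1

/-- `AC ⊔ aby|c ⊔ ay|bc` and `a|bcy` are disjoint. [this work] -/
theorem disjoint_ACabycaybc_Pend :
    Disjoint ((evAC a b c y ∪
        ((openConn a c)ᶜ ∩ (openConn b c)ᶜ ∩ (openConn y c)ᶜ ∩ (openConn a b ∩ openConn a y))) ∪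
        ((openConn a b)ᶜ ∩ (openConn a c)ᶜ ∩ openConn a y ∩ openConn b c))
      (evPend a b c y) := by
  rw [Set.disjoint_left]
  rintro ω ((h1 | h1) | h1) h2
  · exact absurd h1.1 h2.1.1.1.1
  · exact absurd h1.2.1 h2.1.1.1.1
  · exact absurd h1.1.2 h2.1.1.2

/-- glued `X` = `ac|by ⊔ a|by|c`. [this work] -/
theorem glueX_eq :
    ((openConn a b)ᶜ ∩ (openConn c b)ᶜ ∩ openConn b y : Set (BondConfig (Fin n))) =
      ((openConn a b)ᶜ ∩ (openConn a y)ᶜ ∩ openConn a c ∩ openConn b y) ∪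
        ((openConn a b)ᶜ ∩ (openConn a c)ᶜ ∩ (openConn a y)ᶜ ∩ openConn b y ∩ (openConn c y)ᶜ) := by
  ext ω
  simp only [mem_union, mem_inter_iff, mem_compl_iff, mem_oc]
  constructor
  · rintro ⟨⟨nab, ncb⟩, hby⟩
    have nay : ¬ (openGraph ω).Reachable a y := fun h => nab (h.trans hby.symm)
    by_cases hac : (openGraph ω).Reachable a c
    · exact Or.inl ⟨⟨⟨nab, nay⟩, hac⟩, hby⟩
    · exact Or.inr ⟨⟨⟨⟨nab, hac⟩, nay⟩, hby⟩, fun h => ncb (h.trans hby.symm)⟩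
  · rintro (⟨⟨⟨nab, nay⟩, hac⟩, hby⟩ | ⟨⟨⟨⟨nab, nac⟩, nay⟩, hby⟩, ncy⟩)
    · exact ⟨⟨nab, fun h => nab (hac.trans h)⟩, hby⟩
    · exact ⟨⟨nab, fun h => ncy (h.trans hby)⟩, hby⟩

/-- `ac|by` and `a|by|c` are disjoint. [this work] -/
theorem disjoint_acby_abyc :
    Disjoint ((openConn a b)ᶜ ∩ (openConn a y)ᶜ ∩ openConn a c ∩ openConn b y : Set (BondConfig (Fin n)))
      ((openConn a b)ᶜ ∩ (openConn a c)ᶜ ∩ (openConn a y)ᶜ ∩ openConn b y ∩ (openConn c y)ᶜ) := by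
  rw [Set.disjoint_left]
  intro ω h1 h2
  exact absurd h1.1.2 h2.1.1.1.2

/-- glued `C¬A` = `{c~y, b≁a, b≁c} ⊔ ay|b|c`. [this work] -/
theorem glueCnA_eq :
    ((openConn c y ∪ openConn a y) ∩ (openConn a b)ᶜ ∩ (openConn c b)ᶜ : Set (BondConfig (Fin n))) =
      (openConn c y ∩ (openConn a b)ᶜ ∩ (openConn c b)ᶜ) ∪
        ((openConn a c)ᶜ ∩ (openConn b c)ᶜ ∩ (openConn y c)ᶜ ∩ ((openConn a b)ᶜ ∩ openConn a y)) := by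
  ext ω
  simp only [mem_union, mem_inter_iff, mem_compl_iff, mem_oc]
  constructor
  · rintro ⟨⟨h, nab⟩, ncb⟩
    by_cases hcy : (openGraph ω).Reachable c y
    · exact Or.inl ⟨⟨hcy, nab⟩, ncb⟩
    · have hay : (openGraph ω).Reachable a y := h.resolve_left hcy
      exact Or.inr ⟨⟨⟨fun h' => hcy (h'.symm.trans hay), fun h' => ncb h'.symm⟩, fun h' => hcy h'.symm⟩, nab, hay⟩
  · rintro (⟨⟨hcy, nab⟩, ncb⟩ | ⟨⟨⟨-, nbc⟩, -⟩, nab, hay⟩)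
    · exact ⟨⟨Or.inl hcy, nab⟩, ncb⟩
    · exact ⟨⟨Or.inr hay, nab⟩, fun h => nbc h.symm⟩

/-- the two parts of glued `C¬A` are disjoint. [this work] -/
theorem disjoint_glueCnA :
    Disjoint (openConn c y ∩ (openConn a b)ᶜ ∩ (openConn c b)ᶜ : Set (BondConfig (Fin n)))
      ((openConn a c)ᶜ ∩ (openConn b c)ᶜ ∩ (openConn y c)ᶜ ∩ ((openConn a b)ᶜ ∩ openConn a y)) := by
  rw [Set.disjoint_left]
  intro ω h1 h2
  have hcy : (openGraph ω).Reachable c y := h1.1.1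
  exact absurd hcy.symm h2.1.2

/-- `C¬A = {c~y, b≁a, b≁c} ⊔ a|bcy`. [this work] -/
theorem evCnA_eq_c :
    evCnA a b c y = (openConn c y ∩ (openConn a b)ᶜ ∩ (openConn c b)ᶜ) ∪ evPend a b c y := by
  ext ω
  simp only [evCnA, evPend, mem_union, mem_inter_iff, mem_compl_iff, mem_oc]
  constructor
  · rintro ⟨hcy, nab⟩
    by_cases hcb : (openGraph ω).Reachable c b
    · refine Or.inr ⟨⟨⟨⟨nab, fun h => nab (h.trans hcb)⟩, fun h => nab ((h.trans hcy.symm).trans hcb)⟩,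
        hcb.symm⟩, hcb.symm.trans hcy⟩
    · exact Or.inl ⟨⟨hcy, nab⟩, hcb⟩
  · rintro (⟨⟨hcy, nab⟩, -⟩ | ⟨⟨⟨⟨nab, -⟩, -⟩, hbc⟩, hby⟩)
    · exact ⟨hcy, nab⟩
    · exact ⟨hbc.symm.trans hby, nab⟩

/-- the two parts of `C¬A` are disjoint. [this work] -/
theorem disjoint_evCnA_c :
    Disjoint (openConn c y ∩ (openConn a b)ᶜ ∩ (openConn c b)ᶜ : Set (BondConfig (Fin n))) (evPend a b c y) := by
  rw [Set.disjoint_left]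
  intro ω h1 h2
  have hbc : (openGraph ω).Reachable b c := h2.1.2
  exact absurd hbc.symm h1.2

/-- glued `X′` = `∅ ⊔ ac|b|y`. [this work] -/
theorem glueXp_eq :
    ((openConn a b)ᶜ ∩ (openConn c b)ᶜ ∩ (openConn a y)ᶜ ∩ (openConn c y)ᶜ ∩ (openConn b y)ᶜ :
        Set (BondConfig (Fin n))) =
      evEmp a b c y ∪ ((openConn a b)ᶜ ∩ (openConn a y)ᶜ ∩ openConn a c ∩ (openConn b y)ᶜ) := by
  ext ω
  simp only [evEmp, mem_union, mem_inter_iff, mem_compl_iff, mem_oc]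
  constructor
  · rintro ⟨⟨⟨⟨nab, ncb⟩, nay⟩, ncy⟩, nby⟩
    by_cases hac : (openGraph ω).Reachable a c
    · exact Or.inr ⟨⟨⟨nab, nay⟩, hac⟩, nby⟩
    · exact Or.inl ⟨⟨⟨⟨⟨nab, hac⟩, nay⟩, fun h => ncb h.symm⟩, nby⟩, ncy⟩
  · rintro (⟨⟨⟨⟨⟨nab, -⟩, nay⟩, nbc⟩, nby⟩, ncy⟩ | ⟨⟨⟨nab, nay⟩, hac⟩, nby⟩)
    · exact ⟨⟨⟨⟨nab, fun h => nbc h.symm⟩, nay⟩, ncy⟩, nby⟩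
    · exact ⟨⟨⟨⟨nab, fun h => nab (hac.trans h)⟩, nay⟩, fun h => nay (hac.trans h)⟩, nby⟩

/-- `∅` and `ac|b|y` are disjoint. [this work] -/
theorem disjoint_glueXp :
    Disjoint (evEmp a b c y)
      ((openConn a b)ᶜ ∩ (openConn a y)ᶜ ∩ openConn a c ∩ (openConn b y)ᶜ : Set (BondConfig (Fin n))) := by
  rw [Set.disjoint_left]
  intro ω h1 h2
  exact absurd h2.1.2 h1.1.1.1.1.2

/-- `ay|b|c` in the two spellings (`evXp` half vs `pencilAtC`). [this work] -/
theorem cell_ay_b_c_eq :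
    ((openConn a b)ᶜ ∩ (openConn a c)ᶜ ∩ openConn a y ∩ (openConn b c)ᶜ : Set (BondConfig (Fin n))) =
      (openConn a c)ᶜ ∩ (openConn b c)ᶜ ∩ (openConn y c)ᶜ ∩ ((openConn a b)ᶜ ∩ openConn a y) := by
  ext ω
  simp only [mem_inter_iff, mem_compl_iff, mem_oc]
  constructor
  · rintro ⟨⟨⟨nab, nac⟩, hay⟩, nbc⟩
    exact ⟨⟨⟨nac, nbc⟩, fun h => nac (hay.trans h)⟩, nab, hay⟩
  · rintro ⟨⟨⟨nac, nbc⟩, -⟩, nab, hay⟩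
    exact ⟨⟨⟨nab, nac⟩, hay⟩, nbc⟩

/-- `∅` in the two spellings. [this work] -/
theorem evEmp_eq_c :
    evEmp a b c y =
      (openConn a c)ᶜ ∩ (openConn b c)ᶜ ∩ (openConn y c)ᶜ ∩
        ((openConn a b)ᶜ ∩ (openConn a y)ᶜ ∩ (openConn b y)ᶜ) := by
  ext ω
  simp only [evEmp, mem_inter_iff, mem_compl_iff, mem_oc]
  constructor
  · rintro ⟨⟨⟨⟨⟨nab, nac⟩, nay⟩, nbc⟩, nby⟩, ncy⟩
    exact ⟨⟨⟨nac, nbc⟩, fun h => ncy h.symm⟩, ⟨nab, nay⟩, nby⟩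
  · rintro ⟨⟨⟨nac, nbc⟩, nyc⟩, ⟨nab, nay⟩, nby⟩
    exact ⟨⟨⟨⟨⟨nab, nac⟩, nay⟩, nbc⟩, nby⟩, fun h => nyc h.symm⟩

/-- `AΔ = ab|cy ⊔ ab|c|y` in the spelling of `pencilAtC`. [this work] -/
theorem evAD_eq_c :
    evAD a b c y =
      ((openConn a c)ᶜ ∩ (openConn a y)ᶜ ∩ (openConn a b ∩ openConn c y)) ∪
        ((openConn a c)ᶜ ∩ (openConn a y)ᶜ ∩ openConn a b ∩ (openConn c y)ᶜ) := by
  ext ω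
  simp only [evAD, mem_union, mem_inter_iff, mem_compl_iff]
  tauto

/-- the two cells of `AΔ` are disjoint. [this work] -/
theorem disjoint_evAD_c :
    Disjoint ((openConn a c)ᶜ ∩ (openConn a y)ᶜ ∩ (openConn a b ∩ openConn c y) : Set (BondConfig (Fin n)))
      ((openConn a c)ᶜ ∩ (openConn a y)ᶜ ∩ openConn a b ∩ (openConn c y)ᶜ) := by
  rw [Set.disjoint_left]
  intro ω h1 h2
  exact absurd h1.2.2 h2.2

/-- `ab|c|y` in the spelling of `pencilAtC`. [this work] -/
theorem evAB_eq_c :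
    evAB a b c y = (openConn a c)ᶜ ∩ (openConn a y)ᶜ ∩ openConn a b ∩ (openConn c y)ᶜ := by
  ext ω
  simp only [evAB, mem_inter_iff, mem_compl_iff]
  tauto

/-- `a|bcy` in the spelling of `pencilAtC`. [this work] -/
theorem evPend_eq_c :
    evPend a b c y =
      (openConn a b)ᶜ ∩ (openConn a c)ᶜ ∩ (openConn a y)ᶜ ∩ (openConn b y ∩ openConn c y) := by
  ext ω
  simp only [evPend, mem_inter_iff, mem_compl_iff, mem_oc]
  constructor
  · rintro ⟨⟨⟨⟨nab, nac⟩, nay⟩, hbc⟩, hby⟩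
    exact ⟨⟨⟨nab, nac⟩, nay⟩, hby, hbc.symm.trans hby⟩
  · rintro ⟨⟨⟨nab, nac⟩, nay⟩, hby, hcy⟩
    exact ⟨⟨⟨⟨nab, nac⟩, nay⟩, hby.trans hcy.symm⟩, hby⟩

end cells

end Q44b

end Summit.CriticalPhenomena.PercolationContinuityZ3.Theorems

end
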